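import Mathlib
import Literature.Analysis.FluidPDE.Tao2016AveragedNS.ShiftSetCascadeFlows
import Literature.Analysis.FluidPDE.Tao2016AveragedNS.ShiftSetCascadeFlux
import Summits.NavierStokesRegularity.NavierStokesRegularity.Theorems.TaoLadderRungTwoFlatQuadPolarOn
import Summits.NavierStokesRegularity.NavierStokesRegularity.Theorems.TaoLadderRungTwoFlatLinearisedUniqueness
import Summits.NavierStokesRegularity.NavierStokesRegularity.Theorems.TaoLadderRungTwoFlatForcedGronwall
import Summits.NavierStokesRegularity.NavierStokesRegularity.Theorems.TaoLadderRungTwoFlatVariationalExistence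
import Summits.NavierStokesRegularity.NavierStokesRegularity.Theorems.TaoLadderRungTwoFlatHomogeneousL2Field
import Summits.NavierStokesRegularity.NavierStokesRegularity.Theorems.TaoLadderRungTwoFlatGaugeGronwall
import Summits.NavierStokesRegularity.NavierStokesRegularity.Theorems.TaoLadderRungTwoFlatNonlinearHop
import HarnessLib

/-!
# PERSISTENCE of the linearised hop contraction under perturbation of the TABLE and of the REFERENCE SOLUTION
  («contraction modulo the neutral directions is an open condition», in the gauge)
  (helper for item stmt-NavierStokesRegularity-22987 `FlatGapCertificatesV2`, crux K_A♭ of route TaoLadderRungTwoFlat;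
  cell harvest/h2-tao-ladder, p1 g20 — lemma L4 of the analytic lane, linear part: a λ₀ = 1 certificate of the shape of
  (S2) along the pulse of `T♭(ε)` transfers to the renormalised graded lattice, whose table is `α̃ = T♭ + O(ε₀)`
  (`…RatioContinuity.tableAbsSum_renormTable_sub_le`) and whose reference solution is `O(ε₀)`-close)

Scale ratio `1`, nearest-neighbour `𝕊`. `hlin(W, α)` denotes the hypothesis of `…NonlinearHop.nonlinear_hop_estimate`:
every sup-bounded variational solution `u` along `(W, α)` with `ω|u(0)| ≤ B` admits `|c₁|, |c₂| ≤ CB` with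
`ω_{i,k}|u_{i,k+N}(T) − c₁Q_α(W)_{i,k+N}(T) − c₂W_{i,k+N}(T)| ≤ ρB`. The contraction gauge `ω` is assumed
WINDOW-REGULAR (`…GaugeGronwall.IsWindowRegular`, e.g. `g^{k⁺}b^{−k⁻}`) and SHIFT-REGULAR (`ω_{i,j−N} ≤ Γ'ω_{i,j}`);
everything is measured in the read-out gauge `ν_{i,j} = ω_{i,j−N}`.

* `gauge_abs_bilinOn_le_of_sup`, `gauge_abs_linTermOn_le_of_sup`, `gauge_abs_quadTermOn_le_of_sup` — mixed bounds
  (one slot in sup norm, one in a window-regular gauge; no admissibility needed);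
* `gauge_abs_sub_le_of_tables` — gauge continuity of exact solutions in the table:
  `ν|W' − W|(s) ≤ (B_D + ‖α'−α‖₁ M Λ M_ν s)·e^{L's}` (`M_ν` a `ν`-bound of `W'` on `[0,T]`);
* `linHop_persistence` — **`hlin(W, α)` with `(ρ, C)` ⟹ `hlin(W', α')` with `(ρ + δ, C)`**, where
  `δ = Γ'·2Λ(ηM + ‖α‖₁δ_D)·e^{L″T}·T·e^{L'T} + C·(ηMΛM_ν + (2‖α‖₁MΛ + 1)·Δ)` for `‖α' − α‖₁ ≤ η`, `|W' − W| ≤ δ_D` on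
  `[0, T]`, `ν|W'(T) − W(T)| ≤ Δ`, `ν|W'| ≤ M_ν` on `[0,T]` (`L' = 2‖α‖₁MΛ`, `L″ = 2‖α'‖₁MΛ`).

HONEST FRAMING: elementary perturbation theory for MODEL lattices; no pulse is constructed, nothing is certified, nothing
here is a statement about the Navier–Stokes equations.
-/

noncomputable section

-- the sub-problem namespace repeats the summit name by design (D-0017)
set_option linter.dupNamespace false

namespace Summit.NavierStokesRegularity.NavierStokesRegularity.Theorems

open Set Filter Literature.Analysis.FluidPDE Literature.Analysis.FluidPDE.TaoCascade
open scoped Topology Nat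

namespace QuadPolar

variable {m : ℕ}

/-! ### Mixed sup/gauge bounds -/

/-- **Mixed bound for the polarisation**: first slot sup-bounded (`|X| ≤ M_X` at time `t`), second slot gauge-bounded on
the window (`w|Y| ≤ m_Y`), gauge window-regular: `w_{i,n}|B(X,Y)_{i,n}(t)| ≤ ‖α‖₁ M_X Λ m_Y`.
[cite: Tao2016AveragedNS, §4 (4.8); folklore estimate] -/
theorem gauge_abs_bilinOn_le_of_sup {𝕊 : Finset (ℤ × ℤ × ℤ)} (h𝕊 : IsNearestNeighbourSet 𝕊)
    (α : Fin m → Fin m → Fin m → ℤ × ℤ × ℤ → ℝ) {w : Fin m → ℤ → ℝ} {Λ : ℝ} (hw : IsWindowRegular w Λ)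
    {X Y : Fin m → ℤ → ℝ → ℝ} {MX mY : ℝ} {t : ℝ} (hX : ∀ j k, |X j k t| ≤ MX) (hmY : 0 ≤ mY) {i : Fin m} {n : ℤ}
    (hY : ∀ j k, n - 1 ≤ k ∧ k ≤ n + 1 → w j k * |Y j k t| ≤ mY) :
    w i n * |bilinOn 𝕊 0 α X Y i n t| ≤ tableAbsSum 𝕊 α * MX * Λ * mY := by
  obtain ⟨hpos, hΛ, hreg⟩ := hw
  have hwin : 0 < w i n := hpos i n
  have hb : ∀ j k, |windowFam n Y j k t| ≤ Λ * mY / w i n := by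
    intro j k
    unfold windowFam
    split_ifs with hk
    · have hwjk : 0 < w j k := hpos j k
      rw [le_div_iff₀ hwin]
      calc |Y j k t| * w i n ≤ |Y j k t| * (Λ * w j k) := mul_le_mul_of_nonneg_left (hreg i j n k hk) (abs_nonneg _)
        _ = Λ * (w j k * |Y j k t|) := by ring
        _ ≤ Λ * mY := mul_le_mul_of_nonneg_left (hY j k hk) (by linarith)
    · rw [abs_zero]; exact div_nonneg (by nlinarith) hwin.le
  rw [bilinOn_congr_window h𝕊 0 α (X := X) (X' := X) (Y := Y) (Y' := windowFam n Y)
    (fun _ _ _ => rfl) (fun j k hk => (windowFam_of_mem hk Y j t).symm) i]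
  have h := abs_bilinOn_zero_le 𝕊 α hX hb i n
  calc w i n * |bilinOn 𝕊 0 α X (windowFam n Y) i n t| ≤ w i n * (tableAbsSum 𝕊 α * MX * (Λ * mY / w i n)) :=
        mul_le_mul_of_nonneg_left h hwin.le
    _ = tableAbsSum 𝕊 α * MX * Λ * mY := by field_simp

/-- Mixed bound, slots swapped: `w_{i,n}|B(Y,X)_{i,n}(t)| ≤ ‖α‖₁ M_X Λ m_Y`. [cite: Tao2016AveragedNS, §4 (4.8); folklore estimate] -/
theorem gauge_abs_bilinOn_le_of_sup' {𝕊 : Finset (ℤ × ℤ × ℤ)} (h𝕊 : IsNearestNeighbourSet 𝕊)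
    (α : Fin m → Fin m → Fin m → ℤ × ℤ × ℤ → ℝ) {w : Fin m → ℤ → ℝ} {Λ : ℝ} (hw : IsWindowRegular w Λ)
    {X Y : Fin m → ℤ → ℝ → ℝ} {MX mY : ℝ} {t : ℝ} (hX : ∀ j k, |X j k t| ≤ MX) (hmY : 0 ≤ mY) {i : Fin m} {n : ℤ}
    (hY : ∀ j k, n - 1 ≤ k ∧ k ≤ n + 1 → w j k * |Y j k t| ≤ mY) :
    w i n * |bilinOn 𝕊 0 α Y X i n t| ≤ tableAbsSum 𝕊 α * MX * Λ * mY := by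
  obtain ⟨hpos, hΛ, hreg⟩ := hw
  have hwin : 0 < w i n := hpos i n
  have hb : ∀ j k, |windowFam n Y j k t| ≤ Λ * mY / w i n := by
    intro j k
    unfold windowFam
    split_ifs with hk
    · have hwjk : 0 < w j k := hpos j k
      rw [le_div_iff₀ hwin]
      calc |Y j k t| * w i n ≤ |Y j k t| * (Λ * w j k) := mul_le_mul_of_nonneg_left (hreg i j n k hk) (abs_nonneg _)
        _ = Λ * (w j k * |Y j k t|) := by ring
        _ ≤ Λ * mY := mul_le_mul_of_nonneg_left (hY j k hk) (by linarith)
    · rw [abs_zero]; exact div_nonneg (by nlinarith) hwin.le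
  rw [bilinOn_congr_window h𝕊 0 α (X := Y) (X' := windowFam n Y) (Y := X) (Y' := X)
    (fun j k hk => (windowFam_of_mem hk Y j t).symm) (fun _ _ _ => rfl) i]
  have h := abs_bilinOn_zero_le 𝕊 α hb hX i n
  calc w i n * |bilinOn 𝕊 0 α (windowFam n Y) X i n t| ≤ w i n * (tableAbsSum 𝕊 α * (Λ * mY / w i n) * MX) :=
        mul_le_mul_of_nonneg_left h hwin.le
    _ = tableAbsSum 𝕊 α * MX * Λ * mY := by field_simp

/-- **Mixed bound for the linearisation**: background sup-bounded by `M_Ψ`, perturbation gauge-bounded on the window by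
`m`: `w_{i,n}|Lin_Ψ(u)_{i,n}(t)| ≤ 2‖α‖₁ M_Ψ Λ m`. [cite: Tao2016AveragedNS, §4 (4.8); folklore estimate] -/
theorem gauge_abs_linTermOn_le_of_sup {𝕊 : Finset (ℤ × ℤ × ℤ)} (h𝕊 : IsNearestNeighbourSet 𝕊)
    (α : Fin m → Fin m → Fin m → ℤ × ℤ × ℤ → ℝ) {w : Fin m → ℤ → ℝ} {Λ : ℝ} (hw : IsWindowRegular w Λ)
    {Ψ u : Fin m → ℤ → ℝ → ℝ} {MΨ m' : ℝ} {t : ℝ} (hΨ : ∀ j k, |Ψ j k t| ≤ MΨ) (hm' : 0 ≤ m') {i : Fin m} {n : ℤ}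
    (hu : ∀ j k, n - 1 ≤ k ∧ k ≤ n + 1 → w j k * |u j k t| ≤ m') :
    w i n * |linTermOn 𝕊 0 α Ψ u i n t| ≤ 2 * tableAbsSum 𝕊 α * MΨ * Λ * m' := by
  have hwin : 0 < w i n := hw.1 i n
  unfold linTermOn
  have h1 := gauge_abs_bilinOn_le_of_sup h𝕊 α hw hΨ hm' (i := i) (n := n) hu
  have h2 := gauge_abs_bilinOn_le_of_sup' h𝕊 α hw hΨ hm' (i := i) (n := n) hu
  calc w i n * |bilinOn 𝕊 0 α Ψ u i n t + bilinOn 𝕊 0 α u Ψ i n t|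
      ≤ w i n * (|bilinOn 𝕊 0 α Ψ u i n t| + |bilinOn 𝕊 0 α u Ψ i n t|) :=
        mul_le_mul_of_nonneg_left (abs_add_le _ _) hwin.le
    _ ≤ tableAbsSum 𝕊 α * MΨ * Λ * m' + tableAbsSum 𝕊 α * MΨ * Λ * m' := by rw [mul_add]; exact add_le_add h1 h2
    _ = 2 * tableAbsSum 𝕊 α * MΨ * Λ * m' := by ring

/-- **Mixed bound for the quadratic term**: `|X| ≤ M` and `w|X| ≤ m` on the window give `w_{i,n}|Q(X)_{i,n}| ≤ ‖α‖₁MΛm`.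
[cite: Tao2016AveragedNS, §4 (4.8); folklore estimate] -/
theorem gauge_abs_quadTermOn_le_of_sup {𝕊 : Finset (ℤ × ℤ × ℤ)} (h𝕊 : IsNearestNeighbourSet 𝕊)
    (α : Fin m → Fin m → Fin m → ℤ × ℤ × ℤ → ℝ) {w : Fin m → ℤ → ℝ} {Λ : ℝ} (hw : IsWindowRegular w Λ)
    {X : Fin m → ℤ → ℝ → ℝ} {M m' : ℝ} {t : ℝ} (hX : ∀ j k, |X j k t| ≤ M) (hm' : 0 ≤ m') {i : Fin m} {n : ℤ}
    (hXg : ∀ j k, n - 1 ≤ k ∧ k ≤ n + 1 → w j k * |X j k t| ≤ m') :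
    w i n * |quadTermOn 𝕊 0 α X i n t| ≤ tableAbsSum 𝕊 α * M * Λ * m' := by
  rw [quadTermOn_eq_bilinOn]
  exact gauge_abs_bilinOn_le_of_sup h𝕊 α hw hX hm' hXg

/-! ### Gauge continuity in the table -/

/-- **GAUGE CONTINUITY OF EXACT SOLUTIONS IN THE TABLE**: `X` solves the `α`-lattice, `Y` the `β`-lattice, both bounded
by `M`; `w` window-regular; `w|X(0) − Y(0)| ≤ B_D`; `w|Y| ≤ M_w` on `[0, T]`. Then on `[0, T]`
`w|X − Y|(s) ≤ (B_D + ‖α − β‖₁ M Λ M_w · s)·e^{2‖α‖₁MΛ s}` (forced gauge Gronwall, forcing `Q_{α−β}(Y)`).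
[cite: Tao2016AveragedNS, §4 (4.8); folklore (Duhamel–Gronwall)] -/
theorem gauge_abs_sub_le_of_tables {𝕊 : Finset (ℤ × ℤ × ℤ)} (h𝕊 : IsNearestNeighbourSet 𝕊)
    (α β : Fin m → Fin m → Fin m → ℤ × ℤ × ℤ → ℝ) {w : Fin m → ℤ → ℝ} {Λ : ℝ} (hw : IsWindowRegular w Λ)
    {X Y : Fin m → ℤ → ℝ → ℝ} {M Mw BD T : ℝ}
    (hX : ∀ i n t, HasDerivAt (X i n) (quadTermOn 𝕊 0 α X i n t) t)
    (hY : ∀ i n t, HasDerivAt (Y i n) (quadTermOn 𝕊 0 β Y i n t) t)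
    (hXb : ∀ i n t, |X i n t| ≤ M) (hYb : ∀ i n t, |Y i n t| ≤ M) (hMw : 0 ≤ Mw)
    (hYg : ∀ i n, ∀ t ∈ Icc 0 T, w i n * |Y i n t| ≤ Mw) (hBD : ∀ i n, w i n * |X i n 0 - Y i n 0| ≤ BD)
    (i : Fin m) (n : ℤ) {s : ℝ} (hs : s ∈ Icc 0 T) :
    w i n * |X i n s - Y i n s| ≤
      (BD + tableAbsSum 𝕊 (α - β) * M * Λ * Mw * s) * Real.exp (2 * tableAbsSum 𝕊 α * M * Λ * s) := by
  set Ψ : Fin m → ℤ → ℝ → ℝ := (1 / 2 : ℝ) • (X + Y) with hΨ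
  set η : Fin m → ℤ → ℝ → ℝ := X - Y with hη
  set f : Fin m → ℤ → ℝ → ℝ := fun j k t => quadTermOn 𝕊 0 (α - β) Y j k t with hf
  have hXc : ∀ j k, Continuous (X j k) := fun j k => continuous_iff_continuousAt.2 fun t => (hX j k t).continuousAt
  have hYc : ∀ j k, Continuous (Y j k) := fun j k => continuous_iff_continuousAt.2 fun t => (hY j k t).continuousAt
  have hΨc : ∀ j k, Continuous (Ψ j k) := fun j k => by
    show Continuous fun t => (1 / 2 : ℝ) * (X j k t + Y j k t)
    exact continuous_const.mul ((hXc j k).add (hYc j k))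
  have hΨb : ∀ j k t, |Ψ j k t| ≤ M := fun j k t => by
    show |(1 / 2 : ℝ) * (X j k t + Y j k t)| ≤ M
    rw [abs_mul, abs_of_pos (by norm_num : (0 : ℝ) < 1 / 2)]
    linarith [abs_add_le (X j k t) (Y j k t), hXb j k t, hYb j k t]
  have hfc : ∀ j k, Continuous (f j k) := fun j k => by
    simp only [hf, quadTermOn]
    refine continuous_finsetSum _ fun i₁ _ => continuous_finsetSum _ fun i₂ _ =>
      continuous_finsetSum _ fun μ _ => ?_
    exact continuous_const.mul ((hYc _ _).mul (hYc _ _))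
  have hff : ∀ j k, ∀ t ∈ Icc 0 T, w j k * |f j k t| ≤ tableAbsSum 𝕊 (α - β) * M * Λ * Mw := fun j k t ht =>
    gauge_abs_quadTermOn_le_of_sup h𝕊 (α - β) hw (fun j' k' => hYb j' k' t) hMw fun j' k' _ => hYg j' k' t ht
  have hF : 0 ≤ tableAbsSum 𝕊 (α - β) * M * Λ * Mw := by
    have := tableAbsSum_nonneg 𝕊 (α - β); have := hΨb i n 0; have : 0 ≤ M := (abs_nonneg _).trans this
    have := hw.2.1; positivity
  have hder : ∀ j k t, HasDerivAt (η j k) (linTermOn 𝕊 0 α Ψ η j k t + f j k t) t := by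
    intro j k t
    have e : quadTermOn 𝕊 0 α X j k t - quadTermOn 𝕊 0 β Y j k t =
        linTermOn 𝕊 0 α Ψ η j k t + f j k t := by
      have e1 : quadTermOn 𝕊 0 α X j k t - quadTermOn 𝕊 0 α Y j k t = linTermOn 𝕊 0 α Ψ η j k t := by
        rw [hΨ, hη]; exact quadTermOn_sub_eq_linTermOn_mid 𝕊 0 α X Y j k t
      have e2 : quadTermOn 𝕊 0 α Y j k t - quadTermOn 𝕊 0 β Y j k t = f j k t := by
        rw [hf]; exact quadTermOn_sub_table 𝕊 0 α β Y j k t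
      linarith
    rw [← e]
    exact (hX j k t).sub (hY j k t)
  have hηb : ∀ j k, ∀ t ∈ Icc 0 T, |η j k t| ≤ 2 * M := fun j k t _ => by
    show |X j k t - Y j k t| ≤ 2 * M
    linarith [abs_sub (X j k t) (Y j k t), hXb j k t, hYb j k t]
  exact gauge_abs_le_forced_exp h𝕊 α hw hΨc hΨb hfc hff hF hder hηb hBD i n hs


/-! ### Persistence of the linearised hop contraction -/

/-- The polarisation is linear in the table. [cite: Tao2016AveragedNS, §4 (4.8)] -/
theorem bilinOn_sub_table (𝕊 : Finset (ℤ × ℤ × ℤ)) (ε₀ : ℝ) (α β : Fin m → Fin m → Fin m → ℤ × ℤ × ℤ → ℝ)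
    (X Y : Fin m → ℤ → ℝ → ℝ) (i : Fin m) (n : ℤ) (t : ℝ) :
    bilinOn 𝕊 ε₀ α X Y i n t - bilinOn 𝕊 ε₀ β X Y i n t = bilinOn 𝕊 ε₀ (α - β) X Y i n t := by
  simp only [bilinOn, ← Finset.sum_sub_distrib, Pi.sub_apply]
  refine Finset.sum_congr rfl fun _ _ => Finset.sum_congr rfl fun _ _ => Finset.sum_congr rfl fun _ _ => ?_
  ring

/-- The linearisation is linear in the table. [cite: Tao2016AveragedNS, §4 (4.8)] -/
theorem linTermOn_sub_table (𝕊 : Finset (ℤ × ℤ × ℤ)) (ε₀ : ℝ) (α β : Fin m → Fin m → Fin m → ℤ × ℤ × ℤ → ℝ)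
    (W u : Fin m → ℤ → ℝ → ℝ) (i : Fin m) (n : ℤ) (t : ℝ) :
    linTermOn 𝕊 ε₀ α W u i n t - linTermOn 𝕊 ε₀ β W u i n t = linTermOn 𝕊 ε₀ (α - β) W u i n t := by
  simp only [linTermOn, ← bilinOn_sub_table]
  ring

/-- A shifted window-regular gauge is window-regular. [folklore] -/
theorem IsWindowRegular.shift {ω : Fin m → ℤ → ℝ} {Λ : ℝ} (hω : IsWindowRegular ω Λ) (N : ℤ) :
    IsWindowRegular (fun i j => ω i (j - N)) Λ :=
  ⟨fun i j => hω.1 i (j - N), hω.2.1, fun i j n k hk => hω.2.2 i j (n - N) (k - N) (by omega)⟩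

/-- **PERSISTENCE OF THE LINEARISED HOP CONTRACTION** under perturbation of the table (`‖α' − α‖₁ ≤ η`) and of the
reference solution (`|W' − W| ≤ δ_D` on `[0, T]`, `ν|W'(T) − W(T)| ≤ Δ`, `ν|W'| ≤ M_ν` on `[0, T]`, read-out gauge
`ν_{i,j} = ω_{i,j−N}`): if `hlin(W, α)` holds with `(ρ, C)` for all `B`, then `hlin(W', α')` holds with
`(ρ + δ, C)`, `δ = Γ'·2Λ(ηM + ‖α‖₁δ_D)·e^{L″T}·T·e^{L'T} + C·(ηMΛM_ν + (2‖α‖₁MΛ + 1)Δ)`, `L' = 2‖α‖₁MΛ`, `L″ = 2‖α'‖₁MΛ`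
— the linear contraction modulo the neutral directions is an open condition, with explicit modulus.
[cite: Tao2016AveragedNS, §4 (4.8) and §6.3–6.4 (statement shape); route TaoLadderRungTwoFlat, analytic lane L4 (linear part)] -/
theorem linHop_persistence {𝕊 : Finset (ℤ × ℤ × ℤ)} (h𝕊 : IsNearestNeighbourSet 𝕊)
    (α α' : Fin m → Fin m → Fin m → ℤ × ℤ × ℤ → ℝ) {ω : Fin m → ℤ → ℝ} {Λ Γ' : ℝ} (hω : IsWindowRegular ω Λ)
    {N : ℤ} (hΓ' : ∀ i j, ω i (j - N) ≤ Γ' * ω i j)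
    {W W' : Fin m → ℤ → ℝ → ℝ} {M Mν δD Δ η T ρ C : ℝ} (hT : 0 ≤ T)
    (hW : ∀ i n t, HasDerivAt (W i n) (quadTermOn 𝕊 0 α W i n t) t)
    (hW' : ∀ i n t, HasDerivAt (W' i n) (quadTermOn 𝕊 0 α' W' i n t) t)
    (hWb : ∀ i n t, |W i n t| ≤ M) (hW'b : ∀ i n t, |W' i n t| ≤ M) (hMν : 0 ≤ Mν)
    (hW'g : ∀ i j, ∀ t ∈ Icc 0 T, ω i (j - N) * |W' i j t| ≤ Mν)
    (hδD : ∀ i j, ∀ t ∈ Icc 0 T, |W' i j t - W i j t| ≤ δD)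
    (hΔ : ∀ i j, ω i (j - N) * |W' i j T - W i j T| ≤ Δ) (hη : tableAbsSum 𝕊 (α' - α) ≤ η)
    (hlin : ∀ (u : Fin m → ℤ → ℝ → ℝ) (B : ℝ), (∀ i n t, HasDerivAt (u i n) (linTermOn 𝕊 0 α W u i n t) t) →
      (∃ Mu : ℝ, ∀ i n, ∀ t ∈ Icc 0 T, |u i n t| ≤ Mu) → (∀ i k, ω i k * |u i k 0| ≤ B) →
        ∃ c₁ c₂ : ℝ, |c₁| ≤ C * B ∧ |c₂| ≤ C * B ∧
          ∀ i k, ω i k * |u i (k + N) T - c₁ * quadTermOn 𝕊 0 α W i (k + N) T - c₂ * W i (k + N) T| ≤ ρ * B) :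
    ∀ (u' : Fin m → ℤ → ℝ → ℝ) (B : ℝ), (∀ i n t, HasDerivAt (u' i n) (linTermOn 𝕊 0 α' W' u' i n t) t) →
      (∃ Mu : ℝ, ∀ i n, ∀ t ∈ Icc 0 T, |u' i n t| ≤ Mu) → (∀ i k, ω i k * |u' i k 0| ≤ B) →
        ∃ c₁ c₂ : ℝ, |c₁| ≤ C * B ∧ |c₂| ≤ C * B ∧
          ∀ i k, ω i k * |u' i (k + N) T - c₁ * quadTermOn 𝕊 0 α' W' i (k + N) T - c₂ * W' i (k + N) T| ≤
            (ρ + (Γ' * (2 * Λ * (η * M + tableAbsSum 𝕊 α * δD)) * Real.exp (2 * tableAbsSum 𝕊 α' * M * Λ * T) * T *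
              Real.exp (2 * tableAbsSum 𝕊 α * M * Λ * T) +
              C * (η * M * Λ * Mν + (2 * tableAbsSum 𝕊 α * M * Λ + 1) * Δ))) * B := by
  intro u' B hu' hub' hBu'
  obtain ⟨Mu', hMu'⟩ := hub'
  set ν : Fin m → ℤ → ℝ := fun i j => ω i (j - N) with hν
  have hνreg : IsWindowRegular ν Λ := hω.shift N
  have hA := tableAbsSum_nonneg 𝕊 α
  have hA' := tableAbsSum_nonneg 𝕊 α'
  have hAd := tableAbsSum_nonneg 𝕊 (α' - α)
  have hΛ : 0 ≤ Λ := le_trans zero_le_one hω.2.1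
  -- the comparison variational solution along (W, α) from the same data
  have hM0 : 0 ≤ max M 0 := le_max_right _ _
  have hWbm : ∀ j k t, |W j k t| ≤ max M 0 := fun j k t => (hWb j k t).trans (le_max_left _ _)
  have hlipW : ∀ j k t s, |W j k t - W j k s| ≤ tableAbsSum 𝕊 α * (max M 0) ^ 2 * |t - s| :=
    lipschitz_time_of_globalSol 𝕊 α hW hWbm
  have hd0 : ∀ i k, |(fun i k => u' i k 0) i k| ≤ max Mu' 0 := fun i k =>
    (hMu' i k 0 ⟨le_rfl, hT⟩).trans (le_max_left _ _)
  obtain ⟨u, hu0, hud, hub⟩ := exists_linearised_solution 𝕊 α hWbm hM0 (by positivity) hlipW hd0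
  have hubT : ∀ i n, ∀ t ∈ Icc 0 T,
      |u i n t| ≤ max Mu' 0 * Real.exp (2 * tableAbsSum 𝕊 α * max M 0 * T) :=
    fun i n t ht => hub T hT i n t ⟨by linarith [ht.1], ht.2⟩
  obtain ⟨c₁, c₂, hc₁, hc₂, hlinu⟩ := hlin u B hud ⟨_, hubT⟩ (fun i k => by rw [hu0]; exact hBu' i k)
  refine ⟨c₁, c₂, hc₁, hc₂, fun i k => ?_⟩
  -- positivity facts available now that a species `i` is at hand
  have hωpos := hω.1
  have hB0 : 0 ≤ B := le_trans (mul_nonneg (hωpos i k).le (abs_nonneg _)) (hBu' i k)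
  have hΓ'0 : 0 ≤ Γ' := by
    have h := hΓ' i k
    have h1 : 0 < ω i (k - N) := hωpos i (k - N)
    by_contra hneg
    push Not at hneg
    have : Γ' * ω i k < 0 := mul_neg_of_neg_of_pos hneg (hωpos i k)
    linarith
  have hM : 0 ≤ M := (abs_nonneg _).trans (hWb i k 0)
  have hC0 : 0 ≤ C * B := (abs_nonneg _).trans hc₁
  have hη0 : 0 ≤ η := hAd.trans hη
  have hδD0 : 0 ≤ δD := (abs_nonneg _).trans (hδD i k 0 ⟨le_rfl, hT⟩)
  have hΔ0 : 0 ≤ Δ := le_trans (mul_nonneg (hωpos i (k + N - N)).le (abs_nonneg _)) (hΔ i (k + N))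
  -- (1) ν-gauge bound of u' on [0, T]
  set L'' : ℝ := 2 * tableAbsSum 𝕊 α' * M * Λ with hL''
  set mstar : ℝ := Γ' * B * Real.exp (L'' * T) with hmstar
  have hmstar0 : 0 ≤ mstar := by rw [hmstar]; positivity
  have hW'c : ∀ j l, Continuous (W' j l) := fun j l => continuous_iff_continuousAt.2 fun t => (hW' j l t).continuousAt
  have hWc : ∀ j l, Continuous (W j l) := fun j l => continuous_iff_continuousAt.2 fun t => (hW j l t).continuousAt
  have hu'ν0 : ∀ j l, ν j l * |u' j l 0| ≤ Γ' * B := fun j l => by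
    show ω j (l - N) * |u' j l 0| ≤ Γ' * B
    calc ω j (l - N) * |u' j l 0| ≤ Γ' * ω j l * |u' j l 0| :=
          mul_le_mul_of_nonneg_right (hΓ' j l) (abs_nonneg _)
      _ = Γ' * (ω j l * |u' j l 0|) := by ring
      _ ≤ Γ' * B := mul_le_mul_of_nonneg_left (hBu' j l) hΓ'0
  have hu'ν : ∀ j l, ∀ s ∈ Icc 0 T, ν j l * |u' j l s| ≤ mstar := by
    intro j l s hs
    have h := gauge_abs_le_exp h𝕊 α' hνreg hW'c hW'b hu' hMu' hu'ν0 j l hs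
    have hmono : Real.exp (2 * tableAbsSum 𝕊 α' * M * Λ * s) ≤ Real.exp (L'' * T) := by
      rw [hL'']; exact Real.exp_le_exp.mpr (mul_le_mul_of_nonneg_left hs.2 (by positivity))
    calc ν j l * |u' j l s| ≤ Γ' * B * Real.exp (2 * tableAbsSum 𝕊 α' * M * Λ * s) := h
      _ ≤ mstar := by rw [hmstar]; exact mul_le_mul_of_nonneg_left hmono (by positivity)
  -- (2) the difference e = u' − u solves the forced equation along (W, α)
  set e : Fin m → ℤ → ℝ → ℝ := fun j l s => u' j l s - u j l s with he
  set f : Fin m → ℤ → ℝ → ℝ := fun j l s => linTermOn 𝕊 0 α' W' u' j l s - linTermOn 𝕊 0 α W u' j l s with hf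
  have hu'c : ∀ j l, Continuous (u' j l) := fun j l => continuous_iff_continuousAt.2 fun t => (hu' j l t).continuousAt
  have hfc : ∀ j l, Continuous (f j l) := fun j l =>
    (continuous_linTermOn 𝕊 0 α' hW'c hu'c j l).sub (continuous_linTermOn 𝕊 0 α hWc hu'c j l)
  set F : ℝ := 2 * Λ * (η * M + tableAbsSum 𝕊 α * δD) * mstar with hF
  have hF0 : 0 ≤ F := by rw [hF]; positivity
  have hff : ∀ j l, ∀ s ∈ Icc 0 T, ν j l * |f j l s| ≤ F := by
    intro j l s hs
    -- f = Lin_{α'−α, W'}(u') + Lin_{α, W'−W}(u')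
    have ef : f j l s = linTermOn 𝕊 0 (α' - α) W' u' j l s + linTermOn 𝕊 0 α (W' - W) u' j l s := by
      rw [hf, ← linTermOn_sub_table, ← linTermOn_sub_background]; ring
    have h1 := gauge_abs_linTermOn_le_of_sup h𝕊 (α' - α) hνreg (fun j' l' => hW'b j' l' s) hmstar0 (i := j) (n := l)
      (fun j' l' _ => hu'ν j' l' s hs)
    have h2 := gauge_abs_linTermOn_le_of_sup h𝕊 α hνreg (Ψ := W' - W) (MΨ := δD)
      (fun j' l' => by simpa using hδD j' l' s hs) hmstar0 (i := j) (n := l) (fun j' l' _ => hu'ν j' l' s hs)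
    have hνpos : 0 < ν j l := hνreg.1 j l
    rw [ef]
    calc ν j l * |linTermOn 𝕊 0 (α' - α) W' u' j l s + linTermOn 𝕊 0 α (W' - W) u' j l s|
        ≤ ν j l * (|linTermOn 𝕊 0 (α' - α) W' u' j l s| + |linTermOn 𝕊 0 α (W' - W) u' j l s|) :=
          mul_le_mul_of_nonneg_left (abs_add_le _ _) hνpos.le
      _ ≤ 2 * tableAbsSum 𝕊 (α' - α) * M * Λ * mstar + 2 * tableAbsSum 𝕊 α * δD * Λ * mstar := by
          rw [mul_add]; exact add_le_add h1 h2
      _ ≤ F := by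
          rw [hF]
          have : 2 * tableAbsSum 𝕊 (α' - α) * M * Λ * mstar ≤ 2 * η * M * Λ * mstar := by gcongr
          nlinarith
  have hed : ∀ j l s, HasDerivAt (e j l) (linTermOn 𝕊 0 α W e j l s + f j l s) s := by
    intro j l s
    have h := (hu' j l s).sub (hud j l s)
    refine h.congr_deriv ?_
    have : linTermOn 𝕊 0 α W e j l s = linTermOn 𝕊 0 α W u' j l s - linTermOn 𝕊 0 α W u j l s := by
      have hee : e = u' + (-1 : ℝ) • u := by funext a b c; simp [he]; ring
      rw [hee, linTermOn_add, linTermOn_smul]; ring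
    rw [this, hf]; ring
  have heb : ∀ j l, ∀ s ∈ Icc 0 T, |e j l s| ≤ Mu' + max Mu' 0 * Real.exp (2 * tableAbsSum 𝕊 α * max M 0 * T) :=
    fun j l s hs => (abs_sub _ _).trans (add_le_add (hMu' j l s hs) (hubT j l s hs))
  have he0 : ∀ j l, ν j l * |e j l 0| ≤ 0 := fun j l => by simp [he, hu0]
  have hegauge := gauge_abs_le_forced_exp h𝕊 α hνreg hWc hWb hfc hff hF0 hed heb he0 i (k + N) ⟨hT, le_rfl⟩
  rw [zero_add] at hegauge
  -- (3) the neutral directions of (W', α') versus those of (W, α), in the gauge at the read-out site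
  have hνik : ν i (k + N) = ω i k := by simp [hν]
  have hd₂ : ω i k * |W' i (k + N) T - W i (k + N) T| ≤ Δ := by rw [← hνik]; exact hΔ i (k + N)
  have hd₁ : ω i k * |quadTermOn 𝕊 0 α' W' i (k + N) T - quadTermOn 𝕊 0 α W i (k + N) T| ≤
      η * M * Λ * Mν + 2 * tableAbsSum 𝕊 α * M * Λ * Δ := by
    have e1 : quadTermOn 𝕊 0 α' W' i (k + N) T - quadTermOn 𝕊 0 α W i (k + N) T =
        quadTermOn 𝕊 0 (α' - α) W' i (k + N) T +
          linTermOn 𝕊 0 α ((1 / 2 : ℝ) • (W' + W)) (W' - W) i (k + N) T := by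
      rw [← quadTermOn_sub_table, ← quadTermOn_sub_eq_linTermOn_mid]; ring
    have h1 := gauge_abs_quadTermOn_le_of_sup h𝕊 (α' - α) hνreg (fun j l => hW'b j l T) hMν (i := i) (n := k + N)
      (fun j l _ => hW'g j l T ⟨hT, le_rfl⟩)
    have hΨb : ∀ j l, |((1 / 2 : ℝ) • (W' + W)) j l T| ≤ M := fun j l => by
      show |(1 / 2 : ℝ) * (W' j l T + W j l T)| ≤ M
      rw [abs_mul, abs_of_pos (by norm_num : (0 : ℝ) < 1 / 2)]
      linarith [abs_add_le (W' j l T) (W j l T), hW'b j l T, hWb j l T]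
    have h2 := gauge_abs_linTermOn_le_of_sup h𝕊 α hνreg hΨb hΔ0 (i := i) (n := k + N)
      (u := W' - W) (fun j l _ => by simpa using hΔ j l)
    have hνpos : 0 < ν i (k + N) := hνreg.1 i (k + N)
    rw [← hνik, e1]
    calc ν i (k + N) * |quadTermOn 𝕊 0 (α' - α) W' i (k + N) T +
          linTermOn 𝕊 0 α ((1 / 2 : ℝ) • (W' + W)) (W' - W) i (k + N) T|
        ≤ ν i (k + N) * (|quadTermOn 𝕊 0 (α' - α) W' i (k + N) T| +
            |linTermOn 𝕊 0 α ((1 / 2 : ℝ) • (W' + W)) (W' - W) i (k + N) T|) :=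
          mul_le_mul_of_nonneg_left (abs_add_le _ _) hνpos.le
      _ ≤ tableAbsSum 𝕊 (α' - α) * M * Λ * Mν + 2 * tableAbsSum 𝕊 α * M * Λ * Δ := by
          rw [mul_add]; exact add_le_add h1 h2
      _ ≤ η * M * Λ * Mν + 2 * tableAbsSum 𝕊 α * M * Λ * Δ := by gcongr
  -- (4) assemble
  have esplit : u' i (k + N) T - c₁ * quadTermOn 𝕊 0 α' W' i (k + N) T - c₂ * W' i (k + N) T =
      (u i (k + N) T - c₁ * quadTermOn 𝕊 0 α W i (k + N) T - c₂ * W i (k + N) T) + e i (k + N) T -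
        c₁ * (quadTermOn 𝕊 0 α' W' i (k + N) T - quadTermOn 𝕊 0 α W i (k + N) T) -
          c₂ * (W' i (k + N) T - W i (k + N) T) := by rw [he]; ring
  rw [esplit]
  have hω0 : 0 ≤ ω i k := (hωpos i k).le
  calc ω i k * |(u i (k + N) T - c₁ * quadTermOn 𝕊 0 α W i (k + N) T - c₂ * W i (k + N) T) + e i (k + N) T -
        c₁ * (quadTermOn 𝕊 0 α' W' i (k + N) T - quadTermOn 𝕊 0 α W i (k + N) T) -
          c₂ * (W' i (k + N) T - W i (k + N) T)|
      ≤ ω i k * (|u i (k + N) T - c₁ * quadTermOn 𝕊 0 α W i (k + N) T - c₂ * W i (k + N) T| + |e i (k + N) T| +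
          |c₁| * |quadTermOn 𝕊 0 α' W' i (k + N) T - quadTermOn 𝕊 0 α W i (k + N) T| +
            |c₂| * |W' i (k + N) T - W i (k + N) T|) := by
        refine mul_le_mul_of_nonneg_left ?_ hω0
        refine (abs_sub _ _).trans (add_le_add ((abs_sub _ _).trans (add_le_add (abs_add_le _ _) ?_)) ?_)
        · rw [abs_mul]
        · rw [abs_mul]
    _ = ω i k * |u i (k + N) T - c₁ * quadTermOn 𝕊 0 α W i (k + N) T - c₂ * W i (k + N) T| +
          ν i (k + N) * |e i (k + N) T| +
          |c₁| * (ω i k * |quadTermOn 𝕊 0 α' W' i (k + N) T - quadTermOn 𝕊 0 α W i (k + N) T|) +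
          |c₂| * (ω i k * |W' i (k + N) T - W i (k + N) T|) := by rw [hνik]; ring
    _ ≤ ρ * B + F * T * Real.exp (2 * tableAbsSum 𝕊 α * M * Λ * T) +
          C * B * (η * M * Λ * Mν + 2 * tableAbsSum 𝕊 α * M * Λ * Δ) + C * B * Δ :=
        add_le_add (add_le_add (add_le_add (hlinu i k) hegauge)
          (mul_le_mul hc₁ hd₁ (mul_nonneg hω0 (abs_nonneg _)) hC0))
          (mul_le_mul hc₂ hd₂ (mul_nonneg hω0 (abs_nonneg _)) hC0)
    _ = (ρ + (Γ' * (2 * Λ * (η * M + tableAbsSum 𝕊 α * δD)) * Real.exp (2 * tableAbsSum 𝕊 α' * M * Λ * T) * T *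
          Real.exp (2 * tableAbsSum 𝕊 α * M * Λ * T) +
          C * (η * M * Λ * Mν + (2 * tableAbsSum 𝕊 α * M * Λ + 1) * Δ))) * B := by
        rw [hF, hmstar, hL'']; ring

end QuadPolar

end Summit.NavierStokesRegularity.NavierStokesRegularity.Theorems

end
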